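import Summits.CriticalPhenomena.PercolationContinuityZ3.Theorems.PercNearOneGluingNoHeavyPcintBSMRZ6QSRowsA
import HarnessLib

/-!
# PCINT lane, PHASE 12 (site plane method for `d = 6`, reach-4 pieces (two-turn family), long horizon): kernel checks 1/1 of the checkpoint chain for site `ℤ^6`

Cell `prim-pcint`, seat `prim-pcint-4` (gen 0); memo `run/shared/lean/prim/pcint/T-FIBRE-ROUTE.md` §PHASE 12.
Instance `Z6QS`: `d = 6 = 4 + 2` (`k = 4` time axes, the transverse plane), SITE percolation, 337 two-turn reach-4 pieces
(`BSMR.pc4`), 9-point law `A/DA = [1, 5, 22, 95, 754, 95, 22, 5, 1]/1000`, horizon `N = 300` in `6` chunks of `50` (window half-width `112`),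
coefficient tables exact below `M` and flat beyond (…PcintBSMRCoefFlat), Fourier tail (cut-off data, `θ₀ = 1/2`, `q₀ = 75`)
`T = 45819931/10^12`, cell `p = 1879/10^4`. `rowLE (hrowFrom starts[c] (2L)) starts[c+1]`.
-/

namespace Summit.CriticalPhenomena.PercolationContinuityZ3.Theorems.Pcint.BSMR.Z6QS

open Summit.CriticalPhenomena.PercolationContinuityZ3.Theorems.Pcint.BSMR Summit.CriticalPhenomena.PercolationContinuityZ3.Theorems.Pcint.BSMX Summit.CriticalPhenomena.PercolationContinuityZ3.Theorems.Pcint.BSM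

set_option maxHeartbeats 0 in
set_option maxRecDepth 65536 in
/-- Checkpoint `1` dominates the rows continued from checkpoint `0` (the law is restated to keep the statement
instance-specific). -/
theorem hn_0 : lawA = [1, 5, 22, 95, 754, 95, 22, 5, 1] ∧ ∀ c ∈ ((List.range 5).take 1),
    BSMX.rowLE (hrowFrom 4 lawA 1000 1000000000000000 (starts.getD c []) (2 * 50)) (starts.getD (c + 1) []) = true := by
  refine ⟨rfl, ?_⟩
  decide +kernel

set_option maxHeartbeats 0 in
set_option maxRecDepth 65536 in
/-- Checkpoint `2` dominates the rows continued from checkpoint `1` (the law is restated to keep the statement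
instance-specific). -/
theorem hn_1 : lawA = [1, 5, 22, 95, 754, 95, 22, 5, 1] ∧ ∀ c ∈ (((List.range 5).drop 1).take 1),
    BSMX.rowLE (hrowFrom 4 lawA 1000 1000000000000000 (starts.getD c []) (2 * 50)) (starts.getD (c + 1) []) = true := by
  refine ⟨rfl, ?_⟩
  decide +kernel

set_option maxHeartbeats 0 in
set_option maxRecDepth 65536 in
/-- Checkpoint `3` dominates the rows continued from checkpoint `2` (the law is restated to keep the statement
instance-specific). -/
theorem hn_2 : lawA = [1, 5, 22, 95, 754, 95, 22, 5, 1] ∧ ∀ c ∈ (((List.range 5).drop 2).take 1),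
    BSMX.rowLE (hrowFrom 4 lawA 1000 1000000000000000 (starts.getD c []) (2 * 50)) (starts.getD (c + 1) []) = true := by
  refine ⟨rfl, ?_⟩
  decide +kernel

set_option maxHeartbeats 0 in
set_option maxRecDepth 65536 in
/-- Checkpoint `4` dominates the rows continued from checkpoint `3` (the law is restated to keep the statement
instance-specific). -/
theorem hn_3 : lawA = [1, 5, 22, 95, 754, 95, 22, 5, 1] ∧ ∀ c ∈ (((List.range 5).drop 3).take 1),
    BSMX.rowLE (hrowFrom 4 lawA 1000 1000000000000000 (starts.getD c []) (2 * 50)) (starts.getD (c + 1) []) = true := by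
  refine ⟨rfl, ?_⟩
  decide +kernel

set_option maxHeartbeats 0 in
set_option maxRecDepth 65536 in
/-- Checkpoint `5` dominates the rows continued from checkpoint `4` (the law is restated to keep the statement
instance-specific). -/
theorem hn_4 : lawA = [1, 5, 22, 95, 754, 95, 22, 5, 1] ∧ ∀ c ∈ ((List.range 5).drop 4),
    BSMX.rowLE (hrowFrom 4 lawA 1000 1000000000000000 (starts.getD c []) (2 * 50)) (starts.getD (c + 1) []) = true := by
  refine ⟨rfl, ?_⟩
  decide +kernel


end Summit.CriticalPhenomena.PercolationContinuityZ3.Theorems.Pcint.BSMR.Z6QS
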